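import Literature.MathematicalPhysics.QuantumFieldTheory.Balaban1983to89.LatticeWordStokesLocal
import Literature.MathematicalPhysics.QuantumFieldTheory.Balaban1983to89.T4AxialGaugeSmallField

/-!
# `Balaban1983to89.LatticeWordCountBox` — the COUNT BOX of a lattice word lies in a COORDINATE BOX: the located plaquette hypothesis of the tree's crude Stokes bound
# `LatticeWordStokesLocal.dist1_holAt_le_local` («every plaquette based at a site `walkEnd x u`, `u.count ≤ w.count`») FOLLOWS from plaquette-smallness on the torus box
# `castSite '' [z − #(−e_ν in w), z + #(+e_ν in w) + 2]` around `x = castSite z` (`Setup.PlaqSmallOn` on `T4AxialGaugeSmallField.boxPlaqs`) — [Balaban1985Averaging] (19)–(20) bookkeeping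

statement-level skeleton of published theorems with citation tags; proofs where landed; nothing here is a claim about the Yang–Mills mass gap

WHY (cell `pub-ymgap`, width seat `pub-ymgap-dag-n12-w6` g1; node N12 = [B15]; glue brick C4 of the seat's `Q2-DESIGN.md` §8).  The forest-gauge bounds `T4ForestGaugeSameRootBound` (p625609) and
`T4ForestGaugeCorridorBound` carry the plaquette smallness of the minimiser in the COUNT-BOX currency of ym3-torus-p2's `LatticeWordStokesLocal` (the natural one for the commutator
bookkeeping of a word); the N12 knit (dag-n12-c, J-C's `B15Prop1EndpointNearFlatLetters` / this seat's `B15Prop1DatumGaugeNormalisation`) speaks BOXES `castSite '' Set.Icc lo hi`,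
`boxPlaqs lo hi`, `PlaqSmallOn`.  This file is the one-line dictionary between the two: a word `u` using each letter at most as often as `w` displaces by `netDisp u ν ∈
[−#(ν,−) w, +#(ν,+) w]` in each direction, so `walkEnd (castSite z) u = castSite (z + netDisp u)` lies in the box, and a plaquette based there has its four corners in the box enlarged by `2`.

CONTENTS (theorems only; no `def`, no `instance`, no `sorry`): `netDisp_le_count_true`, `neg_count_false_le_netDisp` (public editions of the private counts of
`BlockAveragingPlaquetteBoundLocal` §1), `walkEnd_castSite` (`walkEnd (castSite z) u = castSite (z + netDisp u)`), `exists_castSite_eq` (every torus site is a `castSite`),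
★★ `plaq_countBox_lt_of_plaqSmallOn_boxPlaqs` (THE DICTIONARY: `PlaqSmallOn S δ U`, `boxPlaqs (z − #⁻w) (z + #⁺w + 2) ⊆ S` ⟹ the count-box hypothesis of `dist1_holAt_le_local` at
`castSite z` for `w`), ★★ `plaq_countBox_lt_of_plaqSmallOn_boxPlaqs_length` (the same from the box `[z − |w|, z + |w| + 2]`).

HONEST FRAMING: [folklore] bookkeeping; count-neutral; N12 NOT discharged; nothing continuum ∕ OS ∕ mass-gap ∕ Clay.
-/

noncomputable section

namespace Literature.MathematicalPhysics.QuantumFieldTheory.Balaban1983to89.LatticeWordCountBox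

open T4Continuum T4ReflectionCone
open T4AxialGaugeSmallField (castSite castSite_apply boxPlaqs)
open B7Prop1Explicit (e e_apply)

variable {P : Params} {j : ℕ}

/-! ## §1 Letter counts bound the net displacement -/

/-- `netDisp u ν ≤ #{+e_ν in u}`. [cite: Balaban1985Averaging, (5)-(9) pp.18-19 (lattice bookkeeping)] -/
theorem netDisp_le_count_true {n : ℕ} (ν : Fin n) : ∀ u : List (Letter n), netDisp u ν ≤ (u.count (ν, true) : ℤ)
  | [] => by simp [netDisp]
  | (b, s) :: w => by
      have ih := netDisp_le_count_true ν w
      rw [netDisp_cons, List.count_cons]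
      by_cases hb : b = ν
      · subst hb
        cases s
        · have h : ((b, false) == (b, true)) = false := beq_eq_false_iff_ne.mpr (by simp)
          simp only [h, if_true, Bool.false_eq_true, if_false]
          push_cast; linarith
        · have h : ((b, true) == (b, true)) = true := beq_self_eq_true _
          simp only [h, if_true]
          push_cast; linarith
      · have h1 : ((b, s) == (ν, true)) = false := beq_eq_false_iff_ne.mpr (by simp [hb])
        simp only [h1, hb, if_false, Bool.false_eq_true]
        push_cast; linarith

/-- `−#{−e_ν in u} ≤ netDisp u ν`. [cite: Balaban1985Averaging, (5)-(9) pp.18-19 (lattice bookkeeping)] -/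
theorem neg_count_false_le_netDisp {n : ℕ} (ν : Fin n) : ∀ u : List (Letter n), -(u.count (ν, false) : ℤ) ≤ netDisp u ν
  | [] => by simp [netDisp]
  | (b, s) :: w => by
      have ih := neg_count_false_le_netDisp ν w
      rw [netDisp_cons, List.count_cons]
      by_cases hb : b = ν
      · subst hb
        cases s
        · have h : ((b, false) == (b, false)) = true := beq_self_eq_true _
          simp only [h, if_true, Bool.false_eq_true, if_false]
          push_cast; linarith
        · have h : ((b, true) == (b, false)) = false := beq_eq_false_iff_ne.mpr (by simp)
          simp only [h, if_true, Bool.false_eq_true, if_false]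
          push_cast; linarith
      · have h1 : ((b, s) == (ν, false)) = false := beq_eq_false_iff_ne.mpr (by simp [hb])
        simp only [h1, hb, if_false, Bool.false_eq_true]
        push_cast; linarith

/-! ## §2 Walks from a `castSite` -/

/-- `walkEnd (castSite z) u = castSite (z + netDisp u)`. [cite: Balaban1985Averaging, (5)-(9) pp.18-19 (lattice bookkeeping)] -/
theorem walkEnd_castSite (z : Fin P.d → ℤ) (u : List (Letter P.d)) :
    walkEnd (castSite z : Site P j) u = castSite (fun ν => z ν + netDisp u ν) := by
  funext ν
  rw [walkEnd_apply, castSite_apply, castSite_apply]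
  push_cast
  ring

/-- Every torus site is the projection of an integer point (its coordinate labels) — the periodic identification `T_η = ηℤ^d / periods`. [cite: Balaban1985Averaging, (3)-(5) p.18 (the torus as a quotient lattice; bookkeeping)] -/
theorem exists_castSite_eq (x : Site P j) : ∃ z : Fin P.d → ℤ, (castSite z : Site P j) = x :=
  ⟨fun ν => ((x ν).val : ℤ), funext fun ν => by rw [castSite_apply, Int.cast_natCast, ZMod.natCast_zmod_val]⟩

/-! ## §3 The dictionary -/

/-- ★★ **THE COUNT BOX LIES IN A COORDINATE BOX**: if every torus plaquette with its four corners in the box `[z − #⁻w, z + #⁺w + 2]` (`#^±w (ν) := w.count (ν, ±)`) is within `δ` of `1`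
(`PlaqSmallOn S δ U` with `boxPlaqs … ⊆ S`), then every plaquette based at a site `walkEnd (castSite z) u` with `u.count ≤ w.count` letterwise is within `δ` of `1` — the located hypothesis
of `LatticeWordStokesLocal.dist1_holAt_le_local` ∕ `T4ForestGaugeSameRootBound` ∕ `T4ForestGaugeCorridorBound` at the base point `castSite z` for the word `w`.
[cite: Balaban1985Averaging, (19)-(20) p.21 (bookkeeping of the located Stokes bound)] -/
theorem plaq_countBox_lt_of_plaqSmallOn_boxPlaqs {G : Type*} [GaugeGroup G] (U : GaugeField P j G) (x : Site P j) (z : Fin P.d → ℤ)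
    (hx : (castSite z : Site P j) = x) (w : List (Letter P.d)) {S : Set (Plaq P j)} {δ : ℝ} (hU : PlaqSmallOn S δ U)
    (hS : boxPlaqs (fun ν => z ν - w.count (ν, false)) (fun ν => z ν + w.count (ν, true) + 2) ⊆ S) :
    ∀ u : List (Letter P.d), (∀ l, u.count l ≤ w.count l) →
      ∀ (a b : Fin P.d) (hab : a < b), dist1 (GaugeField.plaqHol U ⟨walkEnd x u, a, b, hab⟩) < δ := by
  subst hx
  intro u hu a b hab
  refine hU _ (hS ⟨fun ν => z ν + netDisp u ν, ?_, ?_, ?_⟩)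
  · intro ν
    have h1 := neg_count_false_le_netDisp ν u
    have h2 : ((u.count (ν, false) : ℕ) : ℤ) ≤ w.count (ν, false) := by exact_mod_cast hu (ν, false)
    show z ν - _ ≤ z ν + netDisp u ν
    linarith
  · intro ν
    have h1 := netDisp_le_count_true ν u
    have h2 : ((u.count (ν, true) : ℕ) : ℤ) ≤ w.count (ν, true) := by exact_mod_cast hu (ν, true)
    show z ν + netDisp u ν + e a ν + e b ν ≤ z ν + _ + 2
    rw [e_apply, e_apply]
    split_ifs <;> linarith
  · exact walkEnd_castSite z u

/-- ★★ **THE SAME WITH THE WORD LENGTH FOR THE COUNTS** (`w.count l ≤ |w|`): plaquette-smallness on the box `[z − |w|, z + |w| + 2]` (an `ℓ^∞`-ball of radius `|w| + 2` around `castSite z`)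
suffices — the form a consumer holding only a LENGTH bound on the forest words (dag-n12-w3's (LEN)) uses. [cite: Balaban1985Averaging, (19)-(20) p.21 (bookkeeping of the located Stokes bound)] -/
theorem plaq_countBox_lt_of_plaqSmallOn_boxPlaqs_length {G : Type*} [GaugeGroup G] (U : GaugeField P j G) (x : Site P j) (z : Fin P.d → ℤ)
    (hx : (castSite z : Site P j) = x) (w : List (Letter P.d)) {S : Set (Plaq P j)} {δ : ℝ} (hU : PlaqSmallOn S δ U)
    (hS : boxPlaqs (fun ν => z ν - w.length) (fun ν => z ν + w.length + 2) ⊆ S) :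
    ∀ u : List (Letter P.d), (∀ l, u.count l ≤ w.count l) →
      ∀ (a b : Fin P.d) (hab : a < b), dist1 (GaugeField.plaqHol U ⟨walkEnd x u, a, b, hab⟩) < δ := by
  refine plaq_countBox_lt_of_plaqSmallOn_boxPlaqs U x z hx w hU (Set.Subset.trans ?_ hS)
  rintro p ⟨z', hlo, hhi, hsrc⟩
  refine ⟨z', fun ν => le_trans ?_ (hlo ν), fun ν => (hhi ν).trans ?_, hsrc⟩
  · have : ((w.count (ν, false) : ℕ) : ℤ) ≤ w.length := by exact_mod_cast List.count_le_length
    show z ν - (w.length : ℤ) ≤ z ν - _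
    linarith
  · have : ((w.count (ν, true) : ℕ) : ℤ) ≤ w.length := by exact_mod_cast List.count_le_length
    show z ν + _ + 2 ≤ z ν + (w.length : ℤ) + 2
    linarith

end Literature.MathematicalPhysics.QuantumFieldTheory.Balaban1983to89.LatticeWordCountBox

end
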